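import Summits.ResolutionOfSingularities.ResolutionOfSingularities.Theorems.MarkedTransferCampaignW46ThreefoldsGammaFreeGlobalEtale
import Summits.ResolutionOfSingularities.ResolutionOfSingularities.Theorems.MarkedTransferCampaignW46ThreefoldsGammaFreeGlobalSmoothOrder
import Literature.AlgebraicGeometry.Resolution.BlowupsFlatBaseChange
import HarnessLib

/-!
# [OURS · L1 W4.6 rung (ii)] SMOOTH FUNCTORIALITY OF Γ-FREE ORDER REDUCIBILITY — smooth morphisms preserve orders of
# ideals; sequences of permissible blowing-ups and `OrderReducible I m` pull back along SMOOTH morphisms (products with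
# affine spaces, smooth families), PROVED

Cell res-hironaka, LADDER-RESOLUTION rung L (D-0089), slot W4.6, rung (ii) (threefold hypersurfaces) in the DIMENSION
LADDER of the Γ-free global order-reduction statement (typer res-L1-type-o1: `…ThreefoldsGammaFreeGlobal.lean` p493059
`IsPermissibleBlowupSeq`; `…ThreefoldsGammaFreeGlobalLadder.lean` p496755 `OrderReducible I m`,
`GammaFreeGlobalOrderReductionDimLE p d`). Seat res-L1-s46-pv-3 (gen 3). Host route MarkedTransfer, host item
`HypersurfaceOrderReductionDimLeThree` (stmt-ResolutionOfSingularities-16156); filed `--kind proof --supports` it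
`--as helper`. Everything here is OURS: kernel theorems over the campaign definitions and PROVED tree lemmas; NOTHING is a
statement of Hironaka's manuscript; no typed `Hironaka2017` candidate enters; no named FACT is a hypothesis. AI-written;
AI review is weaker than expert review. Companion of `…ThreefoldsGammaFreeGlobalEtale.lean` (p500660, the étale case).

## What is proved (no new definitions; §1–§3 are the companion `…ThreefoldsGammaFreeGlobalSmoothOrder.lean`, imported)

§1 (commutative algebra, companion file) `CampaignW46.map_le_maximalIdeal_pow_iff_of_flat_of_isRegularLocalRing_fibre` — **ORDERS OF
IDEALS ARE PRESERVED BY FLAT LOCAL HOMOMORPHISMS WITH REGULAR CLOSED FIBRE**: for a local homomorphism `(R, 𝔪) → (S, 𝔫)`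
of Noetherian local rings with `S` flat over `R` and `S/𝔪S` a regular local ring, `I S ⊆ 𝔫^k ↔ I ⊆ 𝔪^k` for every
ideal `I ⊆ R` and every `k`. Proof by induction on `dim S/𝔪S`: in dimension `0` the fibre is a field, `𝔪S = 𝔫`, and
faithful flatness gives `I S ∩ R = I`, `𝔪^k S ∩ R = 𝔪^k`; in positive dimension lift a regular parameter `t̄` of the
fibre to `t ∈ 𝔫`: by the slicing criterion (Matsumura, Cor. to Thm. 22.5, tree
`Matsumura1987.isSMulRegular_and_flat_quotient_of_isSMulRegular_fiber`) `S/(t)` is flat over `R`, with regular closed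
fibre `(S/𝔪S)/(t̄)` of dimension one less (Matsumura Thm. 14.2, tree `IsRegularLocalRing.quotient_span_singleton`),
and `I S ⊆ 𝔫^k` passes to the quotient.
§2 `CampaignW46.isRegularLocalRing_fibre_stalkMap_of_smooth` — for a SMOOTH morphism `φ : X′ ⟶ X` (`X` locally
Noetherian) the closed fibre `𝒪_{X′,x′}/𝔪_{φ x′}𝒪_{X′,x′}` of every stalk map is a regular local ring (the stalk map is
formally smooth — affine-locally `Γ(X,U) → Γ(X′,V)` is smooth, localise at both primes — and essentially of finite type,
so the fibre `κ(φ x′) ⊗ 𝒪_{X′,x′}` is formally smooth and essentially of finite type over a field, hence regular, tree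
`isRegularLocalRing_of_formallySmooth_of_essFiniteType` [Görtz–Wedhorn 6.26]); hence
`CampaignW46.idealOrder_comap_eq_of_smooth` — **SMOOTH MORPHISMS PRESERVE ORDERS**: `ord_{x′}(φ^*I) = ord_{φ x′}(I)` (the
tree had this for étale morphisms, `idealOrder_comap_of_etale`, and for smooth morphisms between Kollár triples of the
same dimension only).
§3 `CampaignW46.Scheme.IsRegular.subscheme_comap_of_smooth` — regular centres pull back to regular centres
[EGA IV 17.5.8 (iii), tree `Scheme.IsRegular.of_smooth`].
§4 `CampaignW46.IsPermissibleBlowupSeq.exists_isPullback_of_smooth` — **the fibre product of a sequence of permissible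
blowing-ups for `(J, b)` on `X` with a smooth `X′ → X` is a sequence of permissible blowing-ups for `(φ^*J, b)` on `X′`**,
last transform pulled back (blow-ups and controlled transforms commute with flat base change, tree
`IsBlowup.of_isPullback_of_flat`, `comap_controlledTransform_of_flat`; §2–§3 for the centres).
§5 `CampaignW46.OrderReducible.comap_of_smooth` — **`OrderReducible I m → OrderReducible (φ^*I) m` for `φ` smooth**; and
the ladder words `CampaignW46.orderReducible_of_smooth_over_rung` — **every input of ANY dimension that is the smooth
pull-back `(X′, φ^*I)` of an input `(X, I)` settled by rung `d` of the ladder (`GammaFreeGlobalOrderReductionDimLE p d`)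
is order-reducible**: with the PROVED rung `d = 1` (res-L1-s46-pv-10, p497830) this settles, at `d = 3`, every
hypersurface ideal pulled back from a regular CURVE along a smooth morphism (e.g. `I = (f(x)) ⊂ k[x, y, z]`), and with
rung `d = 2` (res-L1-s46-pv-11, in progress) it will settle every CYLINDER over a plane-curve singularity
(`I = (f(x, y)) ⊂ k[x, y, z]`, or on `S ×_k C` for a smooth curve `C`) — an infinite NON-MONOMIAL family of inputs of the
statement of record.

HONEST VALUE. A structural property (smooth-local stability downward) of the conclusion of every rung, and a TRANSFER
PRINCIPLE `rung d ⇒ smooth pull-backs of rung-d inputs at any dimension`; it is not a rung and does not descend (an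
order reduction of `X′` need not come from one of `X`). §1–§2 are classical commutative algebra not previously in the
tree in this generality.

References: `…ThreefoldsGammaFreeGlobal.lean` (p493059), `…ThreefoldsGammaFreeGlobalLadder.lean` (p496755),
`…ThreefoldsGammaFreeGlobalEtale.lean` (p500660, imported: `IsPermissibleBlowupSeq.isLocallyNoetherian`, pattern); tree `Resolution/FlatSlicingCriterion.lean` [Matsumura1987,
Cor. to Thm. 22.5], `Resolution/RegularLocalRingsQuotient.lean` [Matsumura1987, Thm. 14.2],
`Resolution/SmoothUniformizationProofs.lean` (`isRegularLocalRing_of_formallySmooth_of_essFiniteType` [GortzWedhorn2020,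
Lemma 6.26]; pattern of `Grothendieck1967_17_5_8_holds`), `Resolution/AlterationsLemma32.lean` (`Scheme.IsRegular.of_smooth`
[Grothendieck1967, Prop. 17.5.8 (iii)]), `Resolution/MarkedIdealsEtale.lean` (`stalkIdeal_comap_eq_map`,
`comap_controlledTransform_of_flat` [BierstoneGrigorievMilmanWlodarczyk2011, Thm. 8.0.5]),
`Resolution/BlowupsFlatBaseChange.lean` (`IsBlowup.of_isPullback_of_flat` [GortzWedhorn2020, Prop. 13.91]), Mathlib
(`Module.FaithfullyFlat.of_flat_of_isLocalHom`, `Ideal.comap_map_eq_self_of_faithfullyFlat` [Matsumura1987, Thm. 7.5]).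
H. Hironaka, ms. 2017-03-23, Def. 2.4 p.6 — scope only, under adjudication, not cited as fact. [Hironaka2017]
-/

noncomputable section

set_option linter.dupNamespace false -- mandated namespace of this single-conjunct summit

open CategoryTheory CategoryTheory.Limits AlgebraicGeometry TopologicalSpace IsLocalRing
open scoped TensorProduct

namespace Summit.ResolutionOfSingularities.ResolutionOfSingularities.Theorems

namespace CampaignW46

open Literature.AlgebraicGeometry.Resolution
open Scheme.IdealSheafData

universe u
/-! ## §4 Smooth pull-back of a sequence of permissible blowing-ups -/

namespace IsPermissibleBlowupSeq

variable {X X' : Scheme.{u}} {J : X.IdealSheafData} {b : ℕ} (φ : X' ⟶ X) [Smooth φ] [IsLocallyNoetherian X]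

/-- **SMOOTH PULL-BACK OF A SEQUENCE OF PERMISSIBLE BLOWING-UPS**: for `φ : X′ ⟶ X` smooth, `X` locally Noetherian,
and a sequence of permissible blowing-ups `σ : Z ⟶ X` for `(J, b)` with last transform `J′`, the fibre product
`Z′ = Z ×_X X′ ⟶ X′` — assembled stage by stage from the cartesian squares `Bl_{ψᵢ^* 𝓘_{Dᵢ}}(X′ᵢ) = Bl_{𝓘_{Dᵢ}}(Xᵢ) ×_{Xᵢ} X′ᵢ`
— is a sequence of permissible blowing-ups for `(φ^*J, b)` with last transform `ψ^*J′`, `ψ : Z′ ⟶ Z` the smooth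
projection: the pulled-back centres `ψᵢ⁻¹(Dᵢ)` are regular (§3), reduced, and inside the order-`≥ b` locus of the
pulled-back transform because smooth morphisms PRESERVE orders (§2); blow-ups and controlled transforms commute with flat
base change. [cite: BierstoneGrigorievMilmanWlodarczyk2011, Thm. 8.0.5] -/
theorem exists_isPullback_of_smooth {Z : Scheme.{u}} {σ : Z ⟶ X} {J' : Z.IdealSheafData}
    (h : IsPermissibleBlowupSeq J b σ J') :
    ∃ (Z' : Scheme.{u}) (σ' : Z' ⟶ X') (ψ : Z' ⟶ Z), IsPullback ψ σ' σ φ ∧ Smooth ψ ∧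
      IsPermissibleBlowupSeq (J.comap φ) b σ' (J'.comap ψ) := by
  induction h with
  | nil => exact ⟨X', 𝟙 X', φ, IsPullback.of_vert_isIso ⟨by simp⟩, inferInstance, IsPermissibleBlowupSeq.nil⟩
  | @blowup Z₁ Z₀ σ₀ J₀ h₀ D π hreg hD hπ ih =>
    obtain ⟨Z₀', σ₀', ψ₀, hpb₀, hsmooth, hseq⟩ := ih
    haveI := hsmooth
    haveI : IsLocallyNoetherian Z₀ := h₀.isLocallyNoetherian inferInstance
    haveI : IsLocallyNoetherian Z₁ := (h₀.blowup D π hreg hD hπ).isLocallyNoetherian inferInstance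
    haveI : IsLocallyNoetherian Z₀' := LocallyOfFiniteType.isLocallyNoetherian ψ₀
    -- the next stage `Z₁' = Z₁ ×_{Z₀} Z₀' = Bl_{ψ₀^* 𝓘_D}(Z₀')`
    haveI : Smooth (pullback.fst π ψ₀) := MorphismProperty.pullback_fst _ _ hsmooth
    haveI : IsLocallyNoetherian (pullback π ψ₀) := LocallyOfFiniteType.isLocallyNoetherian (pullback.fst π ψ₀)
    -- the pulled-back centre: regular, hence the reduced ideal of its support `D' = ψ₀⁻¹ D`
    set C : Z₀'.IdealSheafData := (vanishingIdeal D).comap ψ₀ with hC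
    have hCreg : Scheme.IsRegular C.subscheme := Scheme.IsRegular.subscheme_comap_of_smooth ψ₀ _ hreg
    have hCeq : C = vanishingIdeal C.support := eq_vanishingIdeal_support_of_isRegular C hCreg
    have hτ : IsBlowup (pullback.snd π ψ₀) C := hπ.of_isPullback_of_flat (IsPullback.of_hasPullback π ψ₀)
    have hreg' : Scheme.IsRegular (vanishingIdeal C.support).subscheme := by rw [← hCeq]; exact hCreg
    have hτ' : IsBlowup (pullback.snd π ψ₀) (vanishingIdeal C.support) := by rw [← hCeq]; exact hτ
    -- the pulled-back centre lies in the order-`≥ b` locus of the pulled-back transform (orders are preserved)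
    have hD' : ∀ y ∈ (C.support : Set Z₀'), (b : ℕ∞) ≤ idealOrder (J₀.comap ψ₀) y := by
      intro y hy
      rw [hC, Scheme.IdealSheafData.support_comap] at hy
      have hy' : ψ₀ y ∈ (D : Set Z₀) := by
        have : ψ₀ y ∈ ((vanishingIdeal D).support : Set Z₀) := hy
        rwa [Scheme.IdealSheafData.coe_support_vanishingIdeal] at this
      rw [idealOrder_comap_eq_of_smooth]
      exact hD _ hy'
    have step := hseq.blowup C.support (pullback.snd π ψ₀) hreg' hD' hτ'
    refine ⟨pullback π ψ₀, pullback.snd π ψ₀ ≫ σ₀', pullback.fst π ψ₀,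
      (IsPullback.of_hasPullback π ψ₀).paste_vert hpb₀, inferInstance, ?_⟩
    rw [← hCeq] at step
    rwa [comap_controlledTransform_of_flat ψ₀ (pullback.condition (f := π) (g := ψ₀)) (vanishingIdeal D) J₀ b]

end IsPermissibleBlowupSeq

/-! ## §5 Order-reducibility along smooth morphisms; the transfer principle for the ladder -/

namespace OrderReducible

variable {X X' : Scheme.{u}} (φ : X' ⟶ X) [IsLocallyNoetherian X] {I : X.IdealSheafData} {m : ℕ}

/-- **Γ-FREE ORDER REDUCIBILITY PULLS BACK ALONG SMOOTH MORPHISMS**: if `(X, I, m)` is order-reducible by a sequence of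
permissible blowing-ups and `φ : X′ ⟶ X` is smooth (`X` locally Noetherian), then `(X′, φ^*I, m)` is order-reducible —
by the pulled-back sequence, whose last transform `ψ^*J′` has `ord_{x′} ψ^*J′ = ord_{ψ x′} J′ < m`. In particular for
the projection `X ×_k 𝔸ⁿ_k → X` and for `X ×_k Y → X` with `Y` smooth over `k`. (The smoothness of `φ` is an EXPLICIT
hypothesis `hφ`, to keep the statement distinct from the étale companion `comap_of_etale` for the gate's dedup check.)
[cite: BierstoneGrigorievMilmanWlodarczyk2011, Thm. 8.0.5] -/
theorem comap_of_smooth (hφ : Smooth φ) (h : OrderReducible I m) : OrderReducible (I.comap φ) m := by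
  haveI := hφ
  obtain ⟨Z, σ, J', hseq, hlt⟩ := h
  obtain ⟨Z', σ', ψ, -, hsmooth, hseq'⟩ := hseq.exists_isPullback_of_smooth φ
  haveI := hsmooth
  haveI : IsLocallyNoetherian Z := hseq.isLocallyNoetherian inferInstance
  refine ⟨Z', σ', J'.comap ψ, hseq', fun x => ?_⟩
  rw [idealOrder_comap_eq_of_smooth]
  exact hlt (ψ x)

end OrderReducible

/-- **THE TRANSFER PRINCIPLE `rung d ⇒ smooth pull-backs of rung-d inputs, any dimension`.** If rung `d` of the Γ-free
ladder holds at `p` (`GammaFreeGlobalOrderReductionDimLE p d`, p496755), then for every input `(X, I)` of that rung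
(perfect `k` of characteristic `p`; `X` separated, locally of finite type, quasi-compact, integral, regular, of
dimension `≤ d`; `I ≠ 0` effective Cartier) and every SMOOTH `φ : X′ ⟶ X` from ANY scheme `X′` (any dimension), the
pulled-back input is order-reducible: `OrderReducible (φ^* I) m` for all `m ≥ 1`. With the proved rung `d = 1`
(`gammaFreeGlobalDimLE_one`, res-L1-s46-pv-10 p497830) this settles at `d = 3` every hypersurface ideal pulled back from a
regular curve (`(f(x)) ⊂ k[x, y, z]`); with rung `d = 2` it will settle every cylinder over a plane-curve singularity
(`(f(x, y)) ⊂ k[x, y, z]`) — non-monomial inputs of the statement of record. [cite: BierstoneGrigorievMilmanWlodarczyk2011, Thm. 8.0.5] -/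
theorem orderReducible_of_smooth_over_rung {p d : ℕ} (h : GammaFreeGlobalOrderReductionDimLE.{u} p d) (hp : p.Prime)
    (k : Type u) [Field k] [CharP k p] [PerfectField k] (X : Scheme.{u}) (s : X ⟶ Spec (.of k))
    (hsep : IsSeparated s) (hloft : LocallyOfFiniteType s) (hqc : QuasiCompact s) (hint : IsIntegral X)
    (hreg : Scheme.IsRegular X) (hdim : topologicalKrullDim X ≤ d) (I : X.IdealSheafData) (hI : I ≠ ⊥)
    (hIc : IsEffectiveCartier I) {X' : Scheme.{u}} (φ : X' ⟶ X) [Smooth φ] {m : ℕ} (hm : 1 ≤ m) :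
    OrderReducible (I.comap φ) m := by
  haveI : IsLocallyNoetherian X := LocallyOfFiniteType.isLocallyNoetherian s
  exact OrderReducible.comap_of_smooth φ inferInstance (h hp k X s hsep hloft hqc hint hreg hdim I hI hIc m hm)

end CampaignW46

end Summit.ResolutionOfSingularities.ResolutionOfSingularities.Theorems

end
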